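import Mathlib
import HarnessLib
import Literature.Analysis.FluidPDE.VectorCalculus
import Summits.NavierStokesRegularity.NavierStokesRegularity.Theorems.UnthreadedRigidityDoorUnthreadedRigidityCoZonalSameDegree

/-!
# W2 door `UnthreadedRigidity` (stmt-NavierStokesRegularity-27585) — ★ BRACKET INJECTIVITY FOR TRIPLES and `IsotypicWindowRigidityL l 3`, every degree

Prover file (engine-1 g72, continuation of DIRECTOR-NS dss_158 (1); `--supports stmt-NavierStokesRegularity-27585 --as helper`; route-independent
imports).  Every 2-vector over a THREE-dimensional space is decomposable, so injectivity of the bracket on PAIRS (`dependent_of_poissonCommute`,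
file `…CoZonalSameDegree`) gives injectivity on TRIPLES: for a linearly independent triple `B₀, B₁, B₂` of degree-`l` solid harmonics and
`c₀₁{B₀,B₁} + c₀₂{B₀,B₂} + c₁₂{B₁,B₂} ≡ 0`: if `c₀₁ ≠ 0` the sum is `{c₀₁B₀ − c₁₂B₂, B₁ + (c₀₂/c₀₁)B₂}`, else it is `{c₀₂B₀ + c₁₂B₁, B₂}`;
either way a commuting pair of degree-`l` harmonics, dependent by the pair theorem, contradicting the independence of the triple unless all
`c` vanish.  ★ `pbr_triple_injective`; ★★ `isotypicWindowRigidityL_three_harmonics : ∀ l ≥ 1, IsotypicWindowRigidityL l 3` (per-degree pipeline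
at `n = 3`, as at `n = 2`).  Tools: `pbr_comb_left`, `pbr_comb_right` (with VirialHorn's `pbr_swap`/`pbr_self`) (the bracket is bilinear over linear combinations of smooth functions).

HONEST LABEL: `n ≤ 3` isotypic windows are SPECIAL data (a restriction of 27585); bridge W for `n ≥ 4` (degrees `l ≥ 2`) stays OPEN (W-ii);
`UnthreadedRigidity` (27585), W2 and NS regularity remain OPEN; nothing here is a statement about Navier–Stokes regularity.  0 kit.
-/

noncomputable section

-- the summit and its single sub-problem share the name (CONVENTIONS §1), as in every Theorems file
set_option linter.dupNamespace false

namespace Summit.NavierStokesRegularity.NavierStokesRegularity.Theorems.UnthreadedRigidity.CoZonal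

open scoped Topology InnerProductSpace
open Filter Set
open Literature.Analysis.FluidPDE (cross)
open Summit.NavierStokesRegularity.NavierStokesRegularity.Theorems.UnthreadedRigidity.VirialHorn
open Summit.NavierStokesRegularity.NavierStokesRegularity.Theorems.UnthreadedRigidity.ProfileHorn (E3)
open Summit.NavierStokesRegularity.NavierStokesRegularity.Theorems.UnthreadedRigidity.ThreadingJets (fluxJetOne separableWindowRigidityL)

/-! ## §1 The bracket over linear combinations -/

section Comb

variable {n : ℕ}

/-- the gradient of a linear combination of smooth functions (private copy). -/
private theorem gradient_comb' (v : Fin n → ℝ) (B : Fin n → E3 → ℝ) (hB : ∀ m, Differentiable ℝ (B m)) (y : E3) :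
    gradient (fun z => ∑ m, v m * B m z) y = ∑ m, v m • gradient (B m) y := by
  have key : ∀ w : E3, ⟪gradient (fun z => ∑ m, v m * B m z) y, w⟫_ℝ = ⟪∑ m, v m • gradient (B m) y, w⟫_ℝ := by
    intro w
    rw [← InnerProductSpace.toDual_apply_apply (𝕜 := ℝ), gradient, LinearIsometryEquiv.apply_symm_apply, fderiv_comb_apply v B hB y w,
      sum_inner]
    refine Finset.sum_congr rfl fun m _ => ?_
    rw [real_inner_smul_left, gradient, InnerProductSpace.toDual_symm_apply]
  exact ext_inner_right ℝ key

/-- `det[a, b, c] = ⟪b, c × a⟫` (private coordinate identity). -/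
private theorem det3_eq_inner_mid (a b c : E3) : det3 a b c = ⟪b, cross c a⟫_ℝ := by
  simp only [det3, PiLp.inner_apply, Fin.sum_univ_three, cross, cross_apply, RCLike.inner_apply, conj_trivial]
  simp; ring

/-- the bracket is linear in its first argument over combinations of smooth functions. -/
theorem pbr_comb_left (v : Fin n → ℝ) (B : Fin n → E3 → ℝ) (hB : ∀ m, Differentiable ℝ (B m)) (g : E3 → ℝ) (y : E3) :
    pbr (fun z => ∑ m, v m * B m z) g y = ∑ m, v m * pbr (B m) g y := by
  unfold pbr
  rw [gradient_comb' v B hB y, det3_eq_inner_mid, sum_inner]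
  refine Finset.sum_congr rfl fun m _ => ?_
  rw [real_inner_smul_left, det3_eq_inner_mid]

/-- the bracket is linear in its second argument over combinations of smooth functions. -/
theorem pbr_comb_right (f : E3 → ℝ) (v : Fin n → ℝ) (B : Fin n → E3 → ℝ) (hB : ∀ m, Differentiable ℝ (B m)) (y : E3) :
    pbr f (fun z => ∑ m, v m * B m z) y = ∑ m, v m * pbr f (B m) y := by
  rw [pbr_swap, pbr_comb_left v B hB f y, ← Finset.sum_neg_distrib]
  refine Finset.sum_congr rfl fun m _ => ?_
  rw [pbr_swap f (B m) y]; ring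

end Comb

/-! ## §2 ★ Injectivity on triples -/

/-- ★ **BRACKET INJECTIVITY FOR TRIPLES, EVERY DEGREE**: for a linearly independent triple of solid harmonics of degree `l ≥ 1`,
`Σ w_{mm′}{B_m,B_{m′}} ≡ 0` forces `w` symmetric (every 2-vector in three dimensions is decomposable; pairs by `dependent_of_poissonCommute`). -/
theorem pbr_triple_injective (l : ℕ) (hl : 1 ≤ l) (B : Fin 3 → E3 → ℝ) (hB : ∀ m, IsSolidHarmonic l (B m))
    (hBi : LinearIndependent ℝ B) (w : Fin 3 → Fin 3 → ℝ)
    (hw : ∀ y : E3, ∑ m, ∑ m', w m m' * pbr (B m) (B m') y = 0) : ∀ m m', w m m' = w m' m := by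
  have hBd : ∀ m, Differentiable ℝ (B m) := fun m => (hB m).contDiff.differentiable (by simp)
  -- the antisymmetrised coefficients
  set c01 : ℝ := w 0 1 - w 1 0 with hc01
  set c02 : ℝ := w 0 2 - w 2 0 with hc02
  set c12 : ℝ := w 1 2 - w 2 1 with hc12
  have hsum : ∀ y : E3, c01 * pbr (B 0) (B 1) y + c02 * pbr (B 0) (B 2) y + c12 * pbr (B 1) (B 2) y = 0 := by
    intro y
    have h := hw y
    simp only [Fin.sum_univ_three, pbr_self, mul_zero, zero_add, add_zero, pbr_swap (B 1) (B 0), pbr_swap (B 2) (B 0),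
      pbr_swap (B 2) (B 1)] at h
    rw [hc01, hc02, hc12]
    linarith
  -- independence of the triple, as a test on coefficient vectors
  have hind : ∀ a0 a1 a2 : ℝ, (∀ y, a0 * B 0 y + a1 * B 1 y + a2 * B 2 y = 0) → a0 = 0 ∧ a1 = 0 ∧ a2 = 0 := by
    intro a0 a1 a2 h
    have hli := Fintype.linearIndependent_iff.1 hBi ![a0, a1, a2] (by
      funext y
      simp only [Fin.sum_univ_three, Finset.sum_apply, Pi.smul_apply, smul_eq_mul, Pi.zero_apply, Matrix.cons_val_zero,
        Matrix.cons_val_one, Matrix.cons_val]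
      exact h y)
    have h0 := hli 0; have h1 := hli 1; have h2 := hli 2
    simp at h0 h1 h2
    exact ⟨h0, h1, h2⟩
  -- the three antisymmetrised coefficients vanish
  have hc : c01 = 0 ∧ c02 = 0 ∧ c12 = 0 := by
    by_cases h01 : c01 = 0
    · -- `{c02 B0 + c12 B1, B2} ≡ 0`
      set Y : E3 → ℝ := fun z => ∑ m, (![c02, c12] : Fin 2 → ℝ) m * (![B 0, B 1] : Fin 2 → E3 → ℝ) m z with hY
      have hYh : IsSolidHarmonic l Y := isSolidHarmonic_comb _ _ (fun m => by fin_cases m <;> simpa using (by first | exact hB 0 | exact hB 1))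
      have hYe : ∀ z, Y z = c02 * B 0 z + c12 * B 1 z := fun z => by simp [hY, Fin.sum_univ_two]
      have hP : PoissonCommute Y (B 2) := by
        intro y
        rw [hY, pbr_comb_left _ _ (fun m => by fin_cases m <;> simpa using (by first | exact hBd 0 | exact hBd 1)) (B 2) y]
        simp only [Fin.sum_univ_two, Matrix.cons_val_zero, Matrix.cons_val_one]
        have := hsum y
        rw [h01, zero_mul, zero_add] at this
        simpa using this
      obtain ⟨a, b, hab, hrel⟩ := dependent_of_poissonCommute hYh (hB 2) hl hP
      have h3 := hind (a * c02) (a * c12) b (fun y => by have := hrel y; rw [hYe] at this; linarith)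
      rcases hab with ha | hb
      · exact ⟨h01, (mul_eq_zero.1 h3.1).resolve_left ha, (mul_eq_zero.1 h3.2.1).resolve_left ha⟩
      · exact absurd h3.2.2 hb
    · -- `{c01 B0 − c12 B2, B1 + (c02/c01) B2} ≡ 0`
      exfalso
      set Y : E3 → ℝ := fun z => ∑ m, (![c01, -c12] : Fin 2 → ℝ) m * (![B 0, B 2] : Fin 2 → E3 → ℝ) m z with hY
      set Z : E3 → ℝ := fun z => ∑ m, (![1, c02 / c01] : Fin 2 → ℝ) m * (![B 1, B 2] : Fin 2 → E3 → ℝ) m z with hZ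
      have hYh : IsSolidHarmonic l Y := isSolidHarmonic_comb _ _ (fun m => by fin_cases m <;> simpa using (by first | exact hB 0 | exact hB 2))
      have hZh : IsSolidHarmonic l Z := isSolidHarmonic_comb _ _ (fun m => by fin_cases m <;> simpa using (by first | exact hB 1 | exact hB 2))
      have hYe : ∀ z, Y z = c01 * B 0 z - c12 * B 2 z := fun z => by simp [hY, Fin.sum_univ_two]; ring
      have hZe : ∀ z, Z z = B 1 z + c02 / c01 * B 2 z := fun z => by simp [hZ, Fin.sum_univ_two]
      have hZd : Differentiable ℝ Z := hZh.contDiff.differentiable (by simp)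
      have hP : PoissonCommute Y Z := by
        intro y
        rw [hY, pbr_comb_left _ _ (fun m => by fin_cases m <;> simpa using (by first | exact hBd 0 | exact hBd 2)) Z y]
        simp only [Fin.sum_univ_two, Matrix.cons_val_zero, Matrix.cons_val_one]
        rw [hZ, pbr_comb_right (B 0) _ _ (fun m => by fin_cases m <;> simpa using (by first | exact hBd 1 | exact hBd 2)) y,
          pbr_comb_right (B 2) _ _ (fun m => by fin_cases m <;> simpa using (by first | exact hBd 1 | exact hBd 2)) y]
        simp only [Fin.sum_univ_two, Matrix.cons_val_zero, Matrix.cons_val_one, pbr_self, pbr_swap (B 2) (B 1)]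
        have := hsum y
        field_simp
        linear_combination c01 * this
      obtain ⟨a, b, hab, hrel⟩ := dependent_of_poissonCommute hYh hZh hl hP
      have h3 := hind (a * c01) b (-(a * c12) + b * (c02 / c01))
        (fun y => by have := hrel y; rw [hYe, hZe] at this; linarith)
      have ha : a = 0 := (mul_eq_zero.1 h3.1).resolve_right h01
      rcases hab with ha' | hb'
      · exact ha' ha
      · exact hb' h3.2.1
  -- conclusion
  obtain ⟨h01, h02, h12⟩ := hc
  have e01 : w 0 1 = w 1 0 := sub_eq_zero.1 h01
  have e02 : w 0 2 = w 2 0 := sub_eq_zero.1 h02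
  have e12 : w 1 2 = w 2 1 := sub_eq_zero.1 h12
  intro m m'
  fin_cases m <;> fin_cases m' <;> first | rfl | exact e01 | exact e01.symm | exact e02 | exact e02.symm | exact e12 | exact e12.symm

/-! ## §3 ★★ `IsotypicWindowRigidityL l 3`, every degree -/

/-- ★★ **THREE-HARMONIC ISOTYPIC WINDOWS ARE RIGID, IN EVERY DEGREE**: `IsotypicWindowRigidityL l 3` for all `l ≥ 1`. -/
theorem isotypicWindowRigidityL_three_harmonics (l : ℕ) (hl : 1 ≤ l) : IsotypicWindowRigidityL l 3 := by
  intro S hS hconn u x₀ hcont hdiv hmild hbdd hunth hiso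
  obtain ⟨B, cf, hB, hslice⟩ := hiso
  refine separableWindowRigidityL hl hS hconn hcont hdiv hmild hbdd hunth fun t ht => ?_
  obtain ⟨hadm, hu⟩ := hslice t ht
  have h0 : ∀ x : E3, fluxJetOne (isoShellL 3 (cf t) B x₀) x₀ x = 0 := fun x => by
    rw [← hu]
    exact fluxJetOne_eq_zero_of_unthreaded_window hS hcont hdiv hmild hbdd hunth ht x
  have hW : WedgeVanishesL 3 (cf t) :=
    wedgeVanishesL_of_fluxJetOne_eq_zero hl hadm x₀ (pbr_triple_injective l hl B hadm.1 hB) h0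
  have hA := windowWedge_analytic_profiles l 3 S hl hS u x₀ hcont hdiv hmild hbdd hunth B cf hB hslice t ht
  obtain ⟨H, Y, hH, hY, hHY⟩ := analyticWedgeSeparableL_holds l 3 (cf t) B x₀ hadm hA hW
  exact ⟨H, Y, hH, hY, by rw [hu]; exact hHY⟩

end Summit.NavierStokesRegularity.NavierStokesRegularity.Theorems.UnthreadedRigidity.CoZonal

end
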